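import Mathlib

/-!
# PercRepro — coloops and level counts of a finite matroid (p3, gen 6)

Infrastructure for mine-2's Theorem B′ (`proofs/MINE2-RLS.md` §13): the decomposition of a finite matroid
`M` into its coloops `C = M.coloops` and the coloop-free part `M ＼ C`.
* `eRk_union_subset_coloops` — `r(X ∪ K) = r(X) + |K|` for `K ⊆ coloops` disjoint from `X`
  (`closure_union_eq_of_subset_coloops`, `union_coloops_indep_iff`);
* `delete_coloops_eRk_eq`, `delete_coloops_eRank_add` — ranks in `M ＼ coloops`: `r_{M＼C}(X) = r(X)` for
  `X ⊆ E ∖ C`, `r(M ＼ C) + |C| = r(M)`;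
* `sum_ncard_rank_delete_coloops_mul_choose_le` — `W_u(M) ≥ Σ_{j ≤ u} W_j(M ＼ C)·C(|C|, u − j)`, the sets
  `S₀ ∪ S₁` (`S₀ ⊆ E ∖ C` of rank `j`, `S₁ ⊆ C` of size `u − j`) being distinct of rank `u`;
* `ncard_ground_le_ncard_rank_one` — loopless: `W_1 ≥ |E|`; `ncard_ground_add_one_le_ncard_rank_top` —
  coloop-free of rank `p₀`: `W_{p₀} ≥ |E| + 1` (`E` and the `E ∖ {w}` are spanning);
* `two_le_eRank_of_simple_coloopFree` — a simple coloop-free matroid with `E ≠ ∅` has rank `≥ 2`.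
`W_u = #{S ⊆ E : r(S) = u}` throughout. Axioms: standard.
-/

open scoped Matroid

namespace PercRepro

open Set Finset

variable {α : Type} {M : Matroid α}

/-- Adding a set of coloops (disjoint from `X`) adds their number to the rank. -/
lemma eRk_union_subset_coloops {X K : Set α} (hX : X ⊆ M.E) (hK : K ⊆ M.coloops) (hXK : Disjoint X K) :
    M.eRk (X ∪ K) = M.eRk X + K.encard := by
  obtain ⟨I, hI⟩ := M.exists_isBasis X hX
  have hIK : M.Indep (I ∪ K) :=
    (Matroid.union_coloops_indep_iff.2 hI.indep).subset (union_subset_union_right I hK)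
  have hbas : M.IsBasis (I ∪ K) (X ∪ K) := by
    refine hIK.isBasis_of_subset_of_subset_closure (union_subset_union_left K hI.subset) ?_
    rw [Matroid.closure_union_eq_of_subset_coloops _ hK]
    exact union_subset_union_left K hI.subset_closure
  rw [← hbas.encard_eq_eRk, encard_union_eq (hXK.mono_left hI.subset), hI.encard_eq_eRk]

/-- In `M ＼ M.coloops`, the rank of a subset of the ground set is its rank in `M`. -/
lemma delete_coloops_eRk_eq {X : Set α} (hX : X ⊆ M.E \ M.coloops) :
    (M ＼ M.coloops).eRk X = M.eRk X := by
  rw [Matroid.delete_eq_restrict, Matroid.restrict_eRk_eq _ hX]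

/-- The rank of `M ＼ M.coloops` is the rank of `M` minus the number of coloops (finite case). -/
lemma delete_coloops_eRank_add [M.Finite] :
    (M ＼ M.coloops).eRank + M.coloops.encard = M.eRank := by
  obtain ⟨B, hB⟩ := M.exists_isBase
  have hCB : M.coloops ⊆ B := hB.coloops_subset
  have hbas : M.IsBasis (B \ M.coloops) (M.E \ M.coloops) := by
    refine (hB.indep.subset sdiff_subset).isBasis_of_subset_of_subset_closure
      (sdiff_subset_sdiff_left hB.subset_ground) ?_
    have h1 : B \ M.coloops ∪ M.coloops = B := sdiff_union_of_subset hCB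
    have h2 := Matroid.closure_union_eq_of_subset_coloops (M := M) (B \ M.coloops) Subset.rfl
    rw [h1, hB.closure_eq] at h2
    intro x hx
    have := h2 ▸ hx.1
    rcases this with h | h
    · exact h
    · exact absurd h hx.2
  have hbase : (M ＼ M.coloops).IsBase (B \ M.coloops) := Matroid.delete_isBase_iff.2 hbas
  rw [← hbase.encard_eq_eRank, ← hB.encard_eq_eRank, ← encard_union_eq disjoint_sdiff_left,
    sdiff_union_of_subset hCB]

/-- `W_u(M) ≥ Σ_{j ≤ u} W_j(M ＼ coloops) · C(#coloops, u − j)`: the sets `S₀ ∪ S₁` with `S₀ ⊆ E ∖ coloops`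
of rank `j` and `S₁ ⊆ coloops` of size `u − j` are pairwise distinct and have rank `u`. -/
lemma sum_ncard_rank_delete_coloops_mul_choose_le [M.Finite] (u : ℕ) :
    ∑ j ∈ Finset.range (u + 1),
      {S : Set α | S ⊆ M.E \ M.coloops ∧ (M ＼ M.coloops).eRk S = (j : ℕ∞)}.ncard *
        M.coloops.ncard.choose (u - j) ≤
      {S : Set α | S ⊆ M.E ∧ M.eRk S = (u : ℕ∞)}.ncard := by
  classical
  have hEfin : M.E.Finite := M.set_finite M.E
  have hCfin : M.coloops.Finite := hEfin.subset M.coloops_subset_ground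
  have hE₀fin : (M.E \ M.coloops).Finite := hEfin.subset sdiff_subset
  have hCcard : hCfin.toFinset.card = M.coloops.ncard := (ncard_eq_toFinset_card _ hCfin).symm
  -- the rank-`j` subsets of `E ∖ coloops`, as finsets
  let s : ℕ → Finset (Finset α) := fun j =>
    hE₀fin.toFinset.powerset.filter (fun S => (M ＼ M.coloops).eRk (S : Set α) = (j : ℕ∞))
  have hmem_s : ∀ j (S : Finset α), S ∈ s j ↔
      (S : Set α) ⊆ M.E \ M.coloops ∧ (M ＼ M.coloops).eRk (S : Set α) = (j : ℕ∞) := by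
    intro j S
    simp only [s, Finset.mem_filter, Finset.mem_powerset]
    constructor
    · rintro ⟨h1, h2⟩
      exact ⟨fun y hy => hE₀fin.mem_toFinset.1 (h1 hy), h2⟩
    · rintro ⟨h1, h2⟩
      exact ⟨fun y hy => hE₀fin.mem_toFinset.2 (h1 hy), h2⟩
  have hscard : ∀ j, (s j).card =
      {S : Set α | S ⊆ M.E \ M.coloops ∧ (M ＼ M.coloops).eRk S = (j : ℕ∞)}.ncard := by
    intro j
    have himg : {S : Set α | S ⊆ M.E \ M.coloops ∧ (M ＼ M.coloops).eRk S = (j : ℕ∞)} =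
        (fun S : Finset α => (S : Set α)) '' ↑(s j) := by
      ext S
      constructor
      · rintro ⟨hSE, hSj⟩
        have hSfin : S.Finite := hE₀fin.subset hSE
        refine ⟨hSfin.toFinset, ?_, hSfin.coe_toFinset⟩
        rw [Finset.mem_coe, hmem_s, hSfin.coe_toFinset]
        exact ⟨hSE, hSj⟩
      · rintro ⟨S', hS', rfl⟩
        rw [Finset.mem_coe, hmem_s] at hS'
        exact hS'
    rw [himg, ncard_image_of_injective _ Finset.coe_injective, ncard_coe_finset]
  -- the pairs, one block per `j`
  let F : Finset (Finset α × Finset α) :=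
    (Finset.range (u + 1)).biUnion (fun j => s j ×ˢ hCfin.toFinset.powersetCard (u - j))
  have hFcard : F.card = ∑ j ∈ Finset.range (u + 1), (s j).card * M.coloops.ncard.choose (u - j) := by
    rw [Finset.card_biUnion]
    · exact Finset.sum_congr rfl (fun j _ => by
        rw [Finset.card_product, Finset.card_powersetCard, hCcard])
    · intro j hj j' hj' hjj'
      change Disjoint _ _
      rw [Finset.disjoint_left]
      rintro ⟨S₀, S₁⟩ h h'
      rw [Finset.mem_product, Finset.mem_powersetCard] at h h'
      rw [Finset.mem_coe, Finset.mem_range] at hj hj'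
      exact hjj' (by omega)
  have hWfin : {S : Set α | S ⊆ M.E ∧ M.eRk S = (u : ℕ∞)}.Finite :=
    hEfin.finite_subsets.subset (fun S hS => hS.1)
  have hmemF : ∀ P ∈ F, ∃ j ∈ Finset.range (u + 1), (P.1 : Set α) ⊆ M.E \ M.coloops ∧
      (M ＼ M.coloops).eRk (P.1 : Set α) = (j : ℕ∞) ∧ (P.2 : Set α) ⊆ M.coloops ∧ P.2.card = u - j := by
    rintro ⟨S₀, S₁⟩ hP
    rw [Finset.mem_biUnion] at hP
    obtain ⟨j, hj, hP⟩ := hP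
    rw [Finset.mem_product, hmem_s, Finset.mem_powersetCard] at hP
    exact ⟨j, hj, hP.1.1, hP.1.2, fun y hy => hCfin.mem_toFinset.1 (hP.2.1 hy), hP.2.2⟩
  have key : ((F : Set (Finset α × Finset α))).ncard ≤
      {S : Set α | S ⊆ M.E ∧ M.eRk S = (u : ℕ∞)}.ncard := by
    refine ncard_le_ncard_of_injOn (fun P => ((P.1 : Set α) ∪ (P.2 : Set α))) ?_ ?_ hWfin
    · intro P hP
      obtain ⟨j, hj, h₀E, h₀rk, h₁C, h₁card⟩ := hmemF P hP
      rw [Finset.mem_range] at hj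
      have hdisj : Disjoint (P.1 : Set α) (P.2 : Set α) :=
        (disjoint_sdiff_left.mono_left h₀E).mono_right h₁C
      refine ⟨union_subset (h₀E.trans sdiff_subset) (h₁C.trans M.coloops_subset_ground), ?_⟩
      rw [eRk_union_subset_coloops (h₀E.trans sdiff_subset) h₁C hdisj, ← delete_coloops_eRk_eq h₀E,
        h₀rk, encard_coe_eq_coe_finsetCard, h₁card]
      have : j + (u - j) = u := by omega
      exact_mod_cast this
    · intro P hP P' hP' hEq
      obtain ⟨j, -, h₀E, -, h₁C, -⟩ := hmemF P hP
      obtain ⟨j', -, h₀E', -, h₁C', -⟩ := hmemF P' hP'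
      simp only at hEq
      have e1 : ∀ (S₀ S₁ : Finset α), (S₀ : Set α) ⊆ M.E \ M.coloops → (S₁ : Set α) ⊆ M.coloops →
          ((S₀ : Set α) ∪ S₁) \ M.coloops = S₀ := by
        intro S₀ S₁ h₀ h₁
        rw [Set.union_sdiff_distrib, sdiff_eq_left.2 (disjoint_sdiff_left.mono_left h₀),
          sdiff_eq_empty.2 h₁, union_empty]
      have e2 : ∀ (S₀ S₁ : Finset α), (S₀ : Set α) ⊆ M.E \ M.coloops → (S₁ : Set α) ⊆ M.coloops →
          ((S₀ : Set α) ∪ S₁) ∩ M.coloops = S₁ := by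
        intro S₀ S₁ h₀ h₁
        rw [Set.union_inter_distrib_right, (disjoint_sdiff_left.mono_left h₀).inter_eq,
          inter_eq_left.2 h₁, empty_union]
      have h1 : (P.1 : Set α) = P'.1 := by
        rw [← e1 P.1 P.2 h₀E h₁C, ← e1 P'.1 P'.2 h₀E' h₁C', hEq]
      have h2 : (P.2 : Set α) = P'.2 := by
        rw [← e2 P.1 P.2 h₀E h₁C, ← e2 P'.1 P'.2 h₀E' h₁C', hEq]
      exact Prod.ext (Finset.coe_injective h1) (Finset.coe_injective h2)
  rw [ncard_coe_finset, hFcard] at key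
  refine le_trans (le_of_eq ?_) key
  exact Finset.sum_congr rfl (fun j _ => by rw [hscard])

/-- In a loopless finite matroid the singletons are rank-`1` sets: `|E| ≤ W_1`. -/
lemma ncard_ground_le_ncard_rank_one [M.Finite] (hloop : ∀ e ∈ M.E, M.Indep {e}) :
    M.E.ncard ≤ {S : Set α | S ⊆ M.E ∧ M.eRk S = ((1 : ℕ) : ℕ∞)}.ncard := by
  have hfin : {S : Set α | S ⊆ M.E ∧ M.eRk S = ((1 : ℕ) : ℕ∞)}.Finite :=
    (M.set_finite M.E).finite_subsets.subset (fun S hS => hS.1)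
  refine ncard_le_ncard_of_injOn (fun e => ({e} : Set α)) ?_ ?_ hfin
  · intro e he
    refine ⟨singleton_subset_iff.2 he, ?_⟩
    rw [(hloop e he).eRk_eq_encard, encard_singleton]
    rfl
  · intro e _ e' _ hEq
    exact singleton_injective hEq

/-- In a coloop-free finite matroid of rank `p₀`, `E` and all the `E ∖ {w}` are spanning: `|E| + 1 ≤ W_{p₀}`. -/
lemma ncard_ground_add_one_le_ncard_rank_top [M.Finite] (hcol : ∀ e, ¬ M.IsColoop e) {p₀ : ℕ}
    (hp : M.eRank = p₀) :
    M.E.ncard + 1 ≤ {S : Set α | S ⊆ M.E ∧ M.eRk S = (p₀ : ℕ∞)}.ncard := by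
  have hEfin : M.E.Finite := M.set_finite M.E
  have hfin : {S : Set α | S ⊆ M.E ∧ M.eRk S = (p₀ : ℕ∞)}.Finite :=
    hEfin.finite_subsets.subset (fun S hS => hS.1)
  -- the sets `E ∖ {w}`
  have himg : ((fun w => M.E \ {w}) '' M.E).ncard = M.E.ncard := by
    refine Set.InjOn.ncard_image (fun w hw w' hw' hEq => ?_)
    by_contra hne
    have : w' ∈ M.E \ {w} := ⟨hw', fun h => hne (mem_singleton_iff.1 h).symm⟩
    rw [hEq] at this
    exact this.2 rfl
  have hsub : insert M.E ((fun w => M.E \ {w}) '' M.E) ⊆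
      {S : Set α | S ⊆ M.E ∧ M.eRk S = (p₀ : ℕ∞)} := by
    rintro S (rfl | ⟨w, hw, rfl⟩)
    · exact ⟨Subset.rfl, by rw [M.eRk_ground, hp]⟩
    · refine ⟨sdiff_subset, ?_⟩
      have hw' : w ∈ M.closure (M.E \ {w}) := by
        have h := hcol w
        rwa [Matroid.isColoop_iff_notMem_closure_compl hw, not_not] at h
      have hcl : M.closure (M.E \ {w}) = M.E := by
        refine (M.closure_subset_ground _).antisymm (fun x hx => ?_)
        by_cases hxw : x = w
        · rw [hxw]; exact hw'
        · exact M.subset_closure (M.E \ {w}) sdiff_subset ⟨hx, hxw⟩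
      rw [← M.eRk_closure_eq, hcl, M.eRk_ground, hp]
  have hnotmem : M.E ∉ (fun w => M.E \ {w}) '' M.E := by
    rintro ⟨w, hw, h⟩
    have : w ∈ (fun w => M.E \ {w}) w := by rw [h]; exact hw
    exact this.2 rfl
  calc M.E.ncard + 1 = (insert M.E ((fun w => M.E \ {w}) '' M.E)).ncard := by
        rw [ncard_insert_of_notMem hnotmem (hEfin.image _), himg]
    _ ≤ _ := ncard_le_ncard hsub hfin

/-- A simple, coloop-free finite matroid with a nonempty ground set has rank at least `2`. -/
lemma two_le_eRank_of_simple_coloopFree [M.Finite] (hsimple : ∀ T ⊆ M.E, T.encard ≤ 2 → M.Indep T)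
    (hcol : ∀ e, ¬ M.IsColoop e) (hne : M.E.Nonempty) {p₀ : ℕ} (hp : M.eRank = p₀) : 2 ≤ p₀ := by
  obtain ⟨e, he⟩ := hne
  have hloop : ∀ x ∈ M.E, M.Indep {x} := fun x hx =>
    hsimple {x} (singleton_subset_iff.2 hx) (by rw [encard_singleton]; norm_num)
  -- rank ≥ 1
  have h1 : (1 : ℕ∞) ≤ M.eRank := by
    have := (hloop e he).encard_le_eRank
    rwa [encard_singleton] at this
  -- rank ≠ 1: otherwise `E = {e}` and `e` is a coloop
  by_contra hlt
  have hp1 : p₀ = 1 := by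
    have : (1 : ℕ∞) ≤ (p₀ : ℕ∞) := hp ▸ h1
    have : 1 ≤ p₀ := by exact_mod_cast this
    omega
  have hsingle : M.E = {e} := by
    refine (Set.eq_singleton_iff_unique_mem.2 ⟨he, fun f hf => ?_⟩)
    by_contra hfe
    have hind : M.Indep {e, f} := hsimple {e, f} (by
      rintro x (rfl | rfl); exact he; exact hf) (by rw [encard_pair (Ne.symm hfe)])
    have := hind.encard_le_eRank
    rw [encard_pair (Ne.symm hfe), hp, hp1] at this
    exact absurd this (by norm_num)
  apply hcol e
  rw [Matroid.isColoop_iff_notMem_closure_compl he, hsingle, sdiff_self,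
    Matroid.closure_empty]
  intro hl
  exact (hloop e he).disjoint_loops.notMem_of_mem_left (mem_singleton e) hl


end PercRepro
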